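import Literature.Probability.Percolation.SharpnessDCTProofs
import Literature.Barriers.CriticalPhenomena.KozmaNachmiasRegeneration
import HarnessLib

/-!
# Stub `stub_contAbove` of crux `ModelFacts` (stmt-CriticalPhenomena-16064), line `pushforward`

Crux: `Summit.CriticalPhenomena.PercolationContinuityZ3.Theses.PercExchangeRateTransport.ModelFacts`
(bookkeeping for the label-coupled anisotropic bond-percolation family on `ℤ²×ℤ`), registered
skeleton `Cruxes/ModelFacts/Lines/pushforward.lean`. This file proves the registered stub
`stub_contAbove` VERBATIM — **continuity from above of the one-arm probabilities** for an
ARBITRARY probability law `μ` on bond configurations of `ℤ³` carried by the edge set `E(ℤ³)`: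

`μ(|C(0)| = ∞) = ⨅ n, μ(0 ↔ ∂Λ_n in Λ_n)`.

Argument (Grimmett 1999, §1.4, `θ(p) = lim P_p(0 ↔ ∂B(n))`; Duminil-Copin–Tassion 2016, §2.2):
* `⋂ₙ {0 ↔ ∂Λ_n} ⊆ {|C(0)| = ∞}` surely (`DCT16.iInter_siteToBoundary_subset_percolatesAt`);
* on `{ω ⊆ E(ℤ³)}`, `{|C(0)| = ∞} ⊆ {0 ↔ ∂Λ_n}` for every `n` (an infinite cluster leaves `Λ_n`;
  first exit, `DCT16.armEvent_of_pathIn`), so the two events agree `μ`-a.e.;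
* `μ (⋂ₙ Aₙ) = ⨅ᵢ μ (⋂_{j ≤ i} A_j)` (`measure_iInter_eq_iInf_measure_iInter_le`) and
  `⋂_{j ≤ i} A_j ⊇ A_i` a.e. by first exit (`mem_siteToBoundary_of_le`), the pattern of
  `DCT16.le_theta_of_forall_le_real_siteToBoundary`;
* pass to `Measure.real` with `ENNReal.toReal_iInf` (all terms finite).
-/

noncomputable section

open MeasureTheory Filter Topology
open Literature.Probability.Percolation Literature.Probability.LatticeModels
open Literature.Probability.Percolation.DCT16

namespace Summit.CriticalPhenomena.PercolationContinuityZ3.Theorems.ModelFacts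

namespace ContAbove

/-- **First exit**: for `ω ⊆ E(ℤ³)`, an infinite open cluster of the origin leaves every box
`Λ_n`, hence `0 ↔ ∂Λ_n` inside `Λ_n` for every `n` (pattern
`DCT16.theta_le_real_siteToBoundary`, Grimmett 1999, §1.4). [folklore] -/
theorem mem_siteToBoundary_of_mem_percolatesAt {ω : Set (Sym2 (Site 3))}
    (hω : ω ⊆ (zdGraph 3).edgeSet) (h : ω ∈ percolatesAt (0 : Site 3)) (n : ℕ) :
    ω ∈ siteToBoundary 3 n := by
  obtain ⟨z, hz, hzn⟩ : ∃ z ∈ openCluster ω 0, z ∉ box 3 n := by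
    by_contra hcon
    push Not at hcon
    exact h ((box 3 n).finite_toSet.subset fun z hz => Finset.mem_coe.2 (hcon z hz))
  rw [← armEvent_zero]
  exact armEvent_of_pathIn hω (DCT16.pathIn_univ_of_reachable hz) (Or.inl (by rwa [sub_zero]))

/-- On `{ω ⊆ E(ℤ³)}`, `{|C(0)| = ∞} = ⋂ₙ {0 ↔ ∂Λ_n}`. [folklore] -/
theorem mem_percolatesAt_iff_mem_iInter {ω : Set (Sym2 (Site 3))}
    (hω : ω ⊆ (zdGraph 3).edgeSet) :
    ω ∈ percolatesAt (0 : Site 3) ↔ ω ∈ ⋂ n, siteToBoundary 3 n :=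
  ⟨fun h => Set.mem_iInter.2 (mem_siteToBoundary_of_mem_percolatesAt hω h),
    fun h => iInter_siteToBoundary_subset_percolatesAt 3 h⟩

/-- `{|C(0)| = ∞} = ⋂ₙ {0 ↔ ∂Λ_n}` almost everywhere, for a law carried by `E(ℤ³)`. [folklore] -/
theorem percolatesAt_ae_eq_iInter (μ : Measure (Set (Sym2 (Site 3))))
    (hae : ∀ᵐ ω ∂μ, ω ⊆ (zdGraph 3).edgeSet) :
    (percolatesAt (0 : Site 3) : Set (Set (Sym2 (Site 3)))) =ᵐ[μ] ⋂ n, siteToBoundary 3 n := by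
  filter_upwards [hae] with ω hω
  exact propext (mem_percolatesAt_iff_mem_iInter hω)

/-- **Continuity of the measure from above along the (a.s. non-increasing) arm events**:
`μ (⋂ₙ {0 ↔ ∂Λ_n}) = ⨅ₙ μ {0 ↔ ∂Λ_n}` for a finite law carried by `E(ℤ³)` (pattern
`DCT16.le_theta_of_forall_le_real_siteToBoundary`). [folklore] -/
theorem measure_iInter_siteToBoundary (μ : Measure (Set (Sym2 (Site 3)))) [IsFiniteMeasure μ]
    (hae : ∀ᵐ ω ∂μ, ω ⊆ (zdGraph 3).edgeSet) :
    μ (⋂ n, siteToBoundary 3 n) = ⨅ n, μ (siteToBoundary 3 n) := by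
  have hmeas : ∀ n, NullMeasurableSet (siteToBoundary 3 n) μ :=
    fun n => (measurableSet_siteToBoundary 3 n).nullMeasurableSet
  rw [measure_iInter_eq_iInf_measure_iInter_le hmeas ⟨0, measure_ne_top _ _⟩]
  refine le_antisymm
    (iInf_mono fun i => measure_mono fun ω hω => (Set.mem_iInter₂.1 hω) i le_rfl)
    (iInf_mono fun i => ?_)
  -- first exit from `Λ_j`, `j ≤ i`, valid for `ω ⊆ E(ℤ³)`
  have hsub : ∀ ω : Set (Sym2 (Site 3)), ω ⊆ (zdGraph 3).edgeSet →
      ω ∈ siteToBoundary 3 i → ω ∈ ⋂ j ≤ i, siteToBoundary 3 j := by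
    intro ω hω hωi
    simp only [Set.mem_iInter]
    exact fun j hj => Literature.Barriers.CriticalPhenomena.mem_siteToBoundary_of_le hω hj hωi
  refine measure_mono_ae ?_
  filter_upwards [hae] with ω hω using hsub ω hω

end ContAbove

/-- **Stub 4 of the line `pushforward` (registered text, verbatim): continuity from above of the
one-arm probabilities, for any probability law on bond configurations of `ℤ³` carried by
`E(ℤ³)`** — `μ(|C(0)| = ∞) = ⨅ n, μ(0 ↔ ∂Λ_n in Λ_n)` (Grimmett 1999, §1.4,
`θ(p) = lim_{n → ∞} P_p(0 ↔ ∂B(n))`, for a general law). [folklore] -/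
theorem stub_contAbove :
    ∀ (μ : Measure (Set (Sym2 (Site 3)))) [IsProbabilityMeasure μ],
    (∀ᵐ ω ∂μ, ω ⊆ (zdGraph 3).edgeSet) →
      μ.real (percolatesAt (0 : Site 3)) = ⨅ n : ℕ, μ.real (siteToBoundary 3 n) := by
  intro μ _ hae
  simp only [measureReal_def]
  rw [measure_congr (ContAbove.percolatesAt_ae_eq_iInter μ hae),
    ContAbove.measure_iInter_siteToBoundary μ hae,
    ENNReal.toReal_iInf fun n => measure_ne_top μ _]

end Summit.CriticalPhenomena.PercolationContinuityZ3.Theorems.ModelFacts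

end
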